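import Mathlib
import Literature.NumberTheory.LFunctions.Zhang2022.TypedSection15AIdentities
import HarnessLib

/-!
# Zhang (2022) §15 p. 81: the integrand of `I₂⁺(ψ)` on `𝔍(1)` IS the integrand of `Θ₂(0,𝐤₁*,𝐚₁*)`,
# and (15.5) reduced to the segment move `𝔍(α) → 𝔍(1)`

Topic `Literature/NumberTheory/LFunctions/Zhang2022` (Landau–Siegel audit tree; verdict-neutral).
Y. Zhang, *Discrete mean estimates and the Landau–Siegel zero*, arXiv:2211.02515v1 (2022)
[Zhang2022LandauSiegel] — **an unrefereed manuscript under adjudication; nothing in this file asserts or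
denies its Theorems 1–2.** ZHANG-L discharge lane, node `Z22:(15.5)` (`Typed.Section15A.Eq15_5`) under
the leaf `Typed.Section15A.Eq15_6 c′ bChi` (§15 p. 81, tex L4081):

> Hence, moving the segment `𝔍(α)` to `𝔍(1)` with a negligible error, we obtain
> `Σ_{ψ∈Ψ₁} I₂⁺(ψ) = Θ₂(0,𝐤₁*,𝐚₁*) + O(ε)` with `κ₁*(m) = (κ₁∗b)(m)`, `a₁*(n) = g̃₃(n)`.

The §15 twin of the tree's `Step16u010.sum_I3pm_one_eq_Theta2` (§16 p. 89). The rewriting of the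
integrand is an IDENTITY of Dirichlet series on the segment `𝔍(1)` (`Re s = 3/2 > 1`), in the χ-absorbed
reading of record `b = χ·b` (`Typed.Section15A.bChi`; module note of `TypedSection15A`):

* `frakk1_mul_omega_eq_theta2Integrand` — for `Re s > 1`, the integrand `𝔨₁(s,ψ)ω(s)` of `I₂^±(ψ)`
  (`𝔨₁ = Z(s,χψ)⁻¹·(L(s+β₁,ψ)L(s+β₂,ψ)/L(s,ψ))·B(s,ψ)K(1−s−β₃,ψ̄)`, `Typed.Section15A.frakk1`) equals
  `Z(s,χψ)⁻¹(Σ_m κ₁*(m)ψ(m)m^{−s})(Σ_{n≤2P₄} g̃₃(n)ψ̄(n)n^{s−1})ω(s)`, the integrand of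
  `Skeleton.Theta2 χ 0 κ₁* g̃₃` at `ψ` — from `§15.u014` (`step15_u014_chi_holds`:
  `L(s+β₁,ψ)L(s+β₂,ψ)B(s,ψ)/L(s,ψ) = Σ_m (κ₁∗χb)(m)ψ(m)m^{−s}`, `σ > 1`) and `§15.u015`
  (`step15_u015_holds`: `K(1−s−β₃,ψ̄) = Σ_n g̃₃(n)ψ̄(n)n^{s−1}`, a finite sum: `g̃₃(n) = 0` for `n > 2P₄`,
  `gtilde3_eq_zero`);
* `I2pm_one_eq_segInt`, `sum_I2pm_one_eq_Theta2` — **`Σ_{ψ∈Ψ₁} I₂(ψ;𝔍(1)) = Θ₂(0,𝐤₁*,𝐚₁*)` EXACTLY**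
  (every `D`, every `χ`; `(p_ψt₀)⁰ = 1`);
* `eq15_5_chi_of_shift` — **EDGE**: (15.5) for `b = χ·b` follows from the per-character segment move
  "`I₂(ψ;𝔍(α)) = I₂(ψ;𝔍(1)) + O(ε)` uniformly for `ψ ∈ Ψ₁`" (the hypothesis of the theorem, stated
  inline), the `#Ψ₁ ≤ 𝔓 ≤ 2P² = 2e^{2𝓛⁹}` copies of `ε = e^{−c𝓛¹⁰}` being `≤ 2e^{−(c/2)𝓛¹⁰}`
  once `𝓛 ≥ 4/c` (as in the tree's `eq15_3_of_u002`; `#Ψ₁ ≤ 𝔓` is `Ded81Edge.card_finsetOf_psiOne_le_frakP`).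

So the analytic content of (15.5) is reduced to the contour move `𝔍(α) → 𝔍(1)` for `I₂⁺` (Cauchy's
theorem on `[½+α, 3/2] × [2πt₀−𝓛₁, 2πt₀+𝓛₁]`, the zeros of `L(s,ψ)`, `ψ ∈ Ψ₁`, lying on `σ = ½` by
Proposition 2.2 (i), and the decay of `ω` on the horizontal edges) — a sibling file. Theorems only: no new
definitions, no named facts; axioms standard. WHAT THIS IS NOT: a proof of (15.5), (15.6), or of anything about Theorems 1–2 of the source or
about Landau–Siegel zeros.

## References

* Y. Zhang, arXiv:2211.02515v1 (2022), §15 pp. 79–81, u001, u003, u014–u017, (15.5) (tex L3994–L4089);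
  §14 p. 76 (definition of `Θ₂`). [cite: Zhang2022LandauSiegel, §15 (15.5) p. 81]
-/

noncomputable section

open Complex Real ComplexConjugate

namespace Literature.NumberTheory.LFunctions.Zhang2022.Typed.Section15A

open Literature.NumberTheory.LFunctions.Zhang2022
open Literature.NumberTheory.LFunctions.Zhang2022.Skeleton

section Identity

variable (c' : ℝ) {D : ℕ} [NeZero D] (χ : DirichletCharacter ℂ D) (x : Chr D)

/-! ## u015 in the range of `Θ₂` -/

omit [NeZero D] χ in
/-- **u015, `Θ₂`-range form**: `K(1−s−β₃,ψ̄) = Σ_{1≤n≤⌊2P₄⌋} g̃₃(n)ψ̄(n)n^{s−1}` (the tree's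
`step15_u015_holds` gives the series `Σ_n g̃₃(n)ψ̄(n)/n^{1−s}`; its terms vanish for `n = 0` and for
`n > 2P₄` (`gtilde3_eq_zero`), and `1/n^{1−s} = n^{s−1}` for `n ≥ 1`).
[cite: Zhang2022LandauSiegel, §15 p. 81 (u015)] -/
theorem Kchar_eq_sum_Icc_gtilde3 (s : ℂ) :
    Kchar D (psiBarFn x) (1 - s - beta3 c' D) =
      ∑ n ∈ Finset.Icc 1 ⌊2 * P4 D⌋₊,
        aStar1 c' D n * conj (x.ψ (n : ZMod x.p)) * (n : ℂ) ^ (s - 1) := by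
  rw [step15_u015_holds c' D x s]
  have hP4 : 0 ≤ 2 * P4 D := by
    have : 0 ≤ ell D := Real.log_natCast_nonneg D
    unfold P4 bigP t0
    positivity
  rw [tsum_eq_sum (s := Finset.Icc 1 ⌊2 * P4 D⌋₊)]
  · refine Finset.sum_congr rfl fun n hn => ?_
    have hn1 : 1 ≤ n := (Finset.mem_Icc.mp hn).1
    have hn0 : (n : ℂ) ≠ 0 := by exact_mod_cast (show n ≠ 0 by omega)
    rw [aStar1, show s - 1 = -(1 - s) by ring, Complex.cpow_neg, div_eq_mul_inv]
  · intro n hn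
    rw [Finset.mem_Icc, not_and_or, not_le, not_le] at hn
    rcases hn with hn | hn
    · have : n = 0 := by omega
      subst this
      simp [gtilde3, gstar]
    · have h2 : 2 * P4 D < n := (Nat.floor_lt hP4).mp hn
      rw [gtilde3_eq_zero c' h2]
      simp

/-! ## The integrand of `I₂^±(ψ)` on `Re s > 1` is the integrand of `Θ₂(0,𝐤₁*,𝐚₁*)` -/

/-- **(15.5), pointwise on `Re s > 1`**: `𝔨₁(s,ψ)ω(s)` (`𝔨₁ = Z(s,χψ)⁻¹·(L(s+β₁,ψ)L(s+β₂,ψ)/L(s,ψ))·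
B(s,ψ)K(1−s−β₃,ψ̄)`, u001) equals
`Z(s,χψ)⁻¹(Σ_m (κ₁∗χb)(m)ψ(m)m^{−s})(Σ_{n≤2P₄} g̃₃(n)ψ̄(n)n^{s−1})ω(s)`, the integrand of
`Θ₂(0,𝐤₁*,𝐚₁*)` at `ψ` (`κ₁* = κ₁∗(χb)`, `a₁* = g̃₃`; u014 at `b = χb` and u015).
[cite: Zhang2022LandauSiegel, §15 (15.5) p. 81] -/
theorem frakk1_mul_omega_eq_theta2Integrand {s : ℂ} (hs : 1 < s.re) :
    frakk1 c' χ x s * omegaW D s =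
      (Zpc χ x s)⁻¹ *
          (∑' m : ℕ, kappaStar1 c' D (bChi D χ) m * x.ψ (m : ZMod x.p) * (m : ℂ) ^ (-s)) *
        (∑ n ∈ Finset.Icc 1 ⌊2 * P4 D⌋₊,
          aStar1 c' D n * conj (x.ψ (n : ZMod x.p)) * (n : ℂ) ^ (s - 1)) *
        omegaW D s := by
  have h14 := step15_u014_chi_holds c' D χ x s hs
  have h14' : x.ψ.LFunction (s + beta1 c' D) * x.ψ.LFunction (s + beta2 c' D) / x.ψ.LFunction s *
      Bpoly χ x s =
        ∑' m : ℕ, kappaStar1 c' D (bChi D χ) m * x.ψ (m : ZMod x.p) * (m : ℂ) ^ (-s) := by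
    rw [div_mul_eq_mul_div, h14]
    refine tsum_congr fun m => ?_
    rw [div_eq_mul_inv, Complex.cpow_neg]
  rw [frakk1, ← Kchar_eq_sum_Icc_gtilde3 c' x s, mul_assoc (Zpc χ x s)⁻¹, h14']

/-- **`I₂(ψ)` on `𝔍(1)` is the `ψ`-term of `Θ₂(0,𝐤₁*,𝐚₁*)`** (the segment `𝔍(1) = 1 + s₀ + i[−𝓛₁,𝓛₁]`
lies on `Re s = 3/2`). [cite: Zhang2022LandauSiegel, §15 (15.5) p. 81; §14 p. 76] -/
theorem I2pm_one_eq_segInt :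
    I2pm c' χ x 1 =
      Lemma81.segInt (t0 D) (ell1 D) 1 fun s =>
        (Zpc χ x s)⁻¹ *
            (∑' m : ℕ, kappaStar1 c' D (bChi D χ) m * x.ψ (m : ZMod x.p) * (m : ℂ) ^ (-s)) *
          (∑ n ∈ Finset.Icc 1 ⌊2 * P4 D⌋₊,
            aStar1 c' D n * conj (x.ψ (n : ZMod x.p)) * (n : ℂ) ^ (s - 1)) *
          omegaW D s := by
  rw [I2pm, Complex.ofReal_one, Lemma81.segInt_def, Lemma81.segInt_def]
  congr 1
  refine intervalIntegral.integral_congr fun v _ => ?_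
  have hre : 1 < ((1 : ℂ) + SmoothWeight.s0 (t0 D) + v * I).re := by
    simp [SmoothWeight.s0]
  exact frakk1_mul_omega_eq_theta2Integrand c' χ x hre

/-- **(15.5) as an identity on `𝔍(1)`**: `Σ_{ψ∈Ψ₁} (1/2πi)∫_{𝔍(1)} 𝔨₁(s,ψ)ω(s)ds = Θ₂(0,𝐤₁*,𝐚₁*)` with
`κ₁* = κ₁∗(χb)`, `a₁* = g̃₃` — EXACT, for every modulus `D` and every `χ` (`Skeleton.Theta2` sums over
`Ψ₁`, integrates over `𝔍(1)`, and `(p_ψt₀)⁰ = 1`). What remains of (15.5) after this identity is the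
contour move `𝔍(α) → 𝔍(1)` (see `eq15_5_chi_of_shift`). [cite: Zhang2022LandauSiegel, §15 (15.5) p. 81] -/
theorem sum_I2pm_one_eq_Theta2 :
    ∑ y ∈ finsetOf (PsiOne χ), I2pm c' χ y 1 =
      Theta2 χ 0 (kappaStar1 c' D (bChi D χ)) (aStar1 c' D) := by
  rw [Theta2]
  refine Finset.sum_congr rfl fun y _ => ?_
  rw [Complex.cpow_zero, one_mul, I2pm_one_eq_segInt c' χ y]

end Identity

/-! ## EDGE: (15.5) ⇐ the segment move `𝔍(α) → 𝔍(1)` for `I₂⁺(ψ)`, `ψ ∈ Ψ₁` -/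

section Edge

/-- `L₀ ≤ log D` once `D ≥ ⌈exp L₀⌉₊`. [folklore] -/
private theorem le_ell_of_ceil_exp_le_155 {L₀ : ℝ} {D : ℕ} (hD : ⌈Real.exp L₀⌉₊ ≤ D) :
    L₀ ≤ ell D := by
  have h : Real.exp L₀ ≤ D := le_trans (Nat.le_ceil _) (by exact_mod_cast hD)
  exact (Real.le_log_iff_exp_le (lt_of_lt_of_le (Real.exp_pos _) h)).mpr h

/-- **EDGE `Z22:(15.5) ⇐` the segment move** (χ-absorbed reading `b = χ·b`): summing
"`I₂(ψ;𝔍(α)) = I₂(ψ;𝔍(1)) + O(ε)`" over `ψ ∈ Ψ₁` and using the exact identity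
`Σ_{ψ∈Ψ₁} I₂(ψ;𝔍(1)) = Θ₂(0,𝐤₁*,𝐚₁*)` (`sum_I2pm_one_eq_Theta2`) gives
"`Σ_{ψ∈Ψ₁} I₂⁺(ψ) = Θ₂(0,𝐤₁*,𝐚₁*) + O(ε)`": the `#Ψ₁ ≤ 𝔓 ≤ 2P² = 2e^{2𝓛⁹}` copies of
`ε = e^{−c𝓛¹⁰}` are `≤ 2e^{−(c/2)𝓛¹⁰}` once `𝓛 ≥ 4/c`. [cite: Zhang2022LandauSiegel, §15 (15.5) p. 81] -/
theorem eq15_5_chi_of_shift (c' : ℝ)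
    (h : ∃ c : ℝ, 0 < c ∧ ∃ C : ℝ, ForAllLarge fun D _ χ => AssumptionA D χ → ∀ x ∈ PsiOne χ,
      ‖I2pm c' χ x (alpha D) - I2pm c' χ x 1‖ ≤ C * Real.exp (-c * ell D ^ 10)) :
    Eq15_5 c' bChi := by
  obtain ⟨c, hc, C, D₁, h⟩ := h
  obtain ⟨D₂, hP⟩ := frakP_le_two_mul_bigP_sq
  refine ⟨c / 2, by positivity, 2 * max C 0,
    max (max D₁ D₂) ⌈Real.exp (4 / c)⌉₊, fun D _ χ hD hq hp hA => ?_⟩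
  have hD₁ : D₁ ≤ D := le_trans (le_trans (le_max_left _ _) (le_max_left _ _)) hD
  have hD₂ : D₂ ≤ D := le_trans (le_trans (le_max_right _ _) (le_max_left _ _)) hD
  have hL : 4 / c ≤ ell D := le_ell_of_ceil_exp_le_155 (le_trans (le_max_right _ _) hD)
  have hcL : 4 ≤ c * ell D := by
    have := (div_le_iff₀ hc).mp hL
    linarith
  have hL0 : 0 < ell D := by
    have : 0 < 4 / c := by positivity
    linarith
  have hx := h D χ hD₁ hq hp hA
  set ε := Real.exp (-c * ell D ^ 10) with hε
  have hC0 : 0 ≤ max C 0 := le_max_right _ _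
  -- the sum of the per-character errors
  rw [← sum_I2pm_one_eq_Theta2 c' χ, ← Finset.sum_sub_distrib]
  have hsum : ‖∑ y ∈ finsetOf (PsiOne χ), (I2pm c' χ y (alpha D) - I2pm c' χ y 1)‖ ≤
      (finsetOf (PsiOne χ)).card * (max C 0 * ε) := by
    calc ‖∑ y ∈ finsetOf (PsiOne χ), (I2pm c' χ y (alpha D) - I2pm c' χ y 1)‖
        ≤ ∑ y ∈ finsetOf (PsiOne χ), ‖I2pm c' χ y (alpha D) - I2pm c' χ y 1‖ := norm_sum_le _ _
      _ ≤ ∑ _y ∈ finsetOf (PsiOne χ), max C 0 * ε := by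
          refine Finset.sum_le_sum fun y hy => ?_
          calc ‖I2pm c' χ y (alpha D) - I2pm c' χ y 1‖ ≤ C * ε := hx y (mem_of_mem_finsetOf hy)
            _ ≤ max C 0 * ε := by gcongr; exact le_max_left _ _
      _ = (finsetOf (PsiOne χ)).card * (max C 0 * ε) := by
          rw [Finset.sum_const, nsmul_eq_mul]
  -- `#Ψ₁ ≤ 𝔓 ≤ 2P² = 2exp(2𝓛⁹)` and `exp(2𝓛⁹)·exp(−c𝓛¹⁰) ≤ exp(−(c/2)𝓛¹⁰)`
  have hcard : ((finsetOf (PsiOne χ)).card : ℝ) ≤ 2 * bigP D ^ 2 :=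
    (Ded81Edge.card_finsetOf_psiOne_le_frakP χ).trans (hP D hD₂)
  have hP2 : bigP D ^ 2 = Real.exp (2 * ell D ^ 9) := by
    rw [bigP, ← Real.exp_nat_mul]; norm_num
  have hexp : Real.exp (2 * ell D ^ 9) * ε ≤ Real.exp (-(c / 2) * ell D ^ 10) := by
    rw [hε, ← Real.exp_add, Real.exp_le_exp]
    have h9 : 0 ≤ ell D ^ 9 := by positivity
    have h10 : ell D ^ 10 = ell D * ell D ^ 9 := by ring
    rw [h10]
    nlinarith
  calc ‖∑ y ∈ finsetOf (PsiOne χ), (I2pm c' χ y (alpha D) - I2pm c' χ y 1)‖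
      ≤ (finsetOf (PsiOne χ)).card * (max C 0 * ε) := hsum
    _ ≤ 2 * bigP D ^ 2 * (max C 0 * ε) := by gcongr
    _ = 2 * max C 0 * (Real.exp (2 * ell D ^ 9) * ε) := by rw [hP2]; ring
    _ ≤ 2 * max C 0 * Real.exp (-(c / 2) * ell D ^ 10) := by gcongr

end Edge

end Literature.NumberTheory.LFunctions.Zhang2022.Typed.Section15A
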